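import Summits.QuantumAdvantage.QuantumAdvantage.Theorems.CubicForrelationSignedCubicForrelationInPrBPPStubHeredity

/-!
# Crux `CubicForrelation.SignedExactCubicForrelationNotPrBPP` (stmt-QuantumAdvantage-13932), line `dual-pingpong-frame`

Helper toward the open stub `stub_finder` (the worst-case M-subspace finder): **the M-subspace is the RANK LOCUS in the
non-degenerate regime.**

Setting (coordinate-free, Mathlib linear algebra over `𝔽₂`): `T` a trilinear form on `𝔽₂ⁿ`, symmetric in its first two and in
its last two slots (the third-derivative tensor `T_b` of a cubic Boolean function `b`); `E` a subspace with `T(E, E, ·) = 0` and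
`n ≤ 2 dim E` (for an exact cubic pair: a half-dimensional M-subspace `V` of `b`, whose second — hence third — derivatives along
`V` vanish). Write `R_ξ := ker (T ξ) = {v | T(ξ, v, ·) = 0}` for the polar radical of the slice at `ξ`.

* `le_ker_of_mem` — for `ξ ∈ E`, `E ≤ R_ξ` (isotropy + symmetry), so `dim R_ξ ≥ dim E`.
* `finrank_ker_lt_of_not_mem` — if every NON-member `ξ ∉ E` has `2·dim(E ⊓ R_ξ) < dim E` (in Maiorana–McFarland coordinates:
  every non-zero direction `w''` of the hidden quadratic permutation has differential kernel of dimension `< m/2`), then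
  `dim R_ξ < dim E` for every `ξ ∉ E` — by the landed SEED HEREDITY `stub_heredity` (`dim R_ξ ≤ 2 dim (E ⊓ R_ξ)`, crux r7's line
  `polar-radical-seeds`).
* `mem_iff_finrank_le` — hence `ξ ∈ E ↔ dim E ≤ dim R_ξ`: under non-degeneracy the M-subspace is CUT OUT by a rank condition on
  the slices of the cubic tensor; in particular it is then unique, and membership in it is decidable by one Gaussian elimination
  (the exact truth test used by the finder's seed filter and radical descent; see the line file `Lines/dual_pingpong_frame.lean`,
  stub `stub_finder`).
-/

noncomputable section

set_option linter.dupNamespace false -- D-0017: single-problem summit ⇒ `QuantumAdvantage.QuantumAdvantage` by design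

namespace Summit.QuantumAdvantage.QuantumAdvantage.Theorems.SignedExactCubicForrelationNotPrBPP.Finder

/-- If `T` is symmetric in its first two slots and isotropic on `E` (`T(E,E,·) = 0`), then for `ξ ∈ E` the whole of `E` lies
in the polar radical `ker (T ξ)`. [folklore] -/
theorem le_ker_of_mem {n : ℕ}
    (T : (Fin n → ZMod 2) →ₗ[ZMod 2] (Fin n → ZMod 2) →ₗ[ZMod 2] (Fin n → ZMod 2) →ₗ[ZMod 2] ZMod 2)
    (E : Submodule (ZMod 2) (Fin n → ZMod 2))
    (hsym₁ : ∀ u v w, T u v w = T v u w) (hiso : ∀ e ∈ E, ∀ e' ∈ E, ∀ w, T e e' w = 0)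
    {ξ : Fin n → ZMod 2} (hξ : ξ ∈ E) : E ≤ LinearMap.ker (T ξ) := by
  intro e he
  rw [LinearMap.mem_ker]
  refine LinearMap.ext fun w => ?_
  rw [hsym₁, LinearMap.zero_apply]
  exact hiso e he ξ hξ w

/-- **Non-members have small polar radicals.** With `T` symmetric (both adjacent transpositions), isotropic on `E`,
`n ≤ 2 dim E`, and the non-degeneracy hypothesis `2 dim (E ⊓ ker (T ξ)) < dim E` for every `ξ ∉ E`, every non-member `ξ` has
`dim ker (T ξ) < dim E`. Proof: seed heredity `dim ker (T ξ) ≤ 2 dim (E ⊓ ker (T ξ))` (landed `stub_heredity`). [folklore] -/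
theorem finrank_ker_lt_of_not_mem {n : ℕ}
    (T : (Fin n → ZMod 2) →ₗ[ZMod 2] (Fin n → ZMod 2) →ₗ[ZMod 2] (Fin n → ZMod 2) →ₗ[ZMod 2] ZMod 2)
    (E : Submodule (ZMod 2) (Fin n → ZMod 2))
    (hsym₁ : ∀ u v w, T u v w = T v u w) (hsym₂ : ∀ u v w, T u v w = T u w v)
    (hiso : ∀ e ∈ E, ∀ e' ∈ E, ∀ w, T e e' w = 0) (hn : n ≤ 2 * Module.finrank (ZMod 2) E)
    (hnd : ∀ ξ, ξ ∉ E →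
      2 * Module.finrank (ZMod 2) ↥(E ⊓ LinearMap.ker (T ξ)) < Module.finrank (ZMod 2) E)
    {ξ : Fin n → ZMod 2} (hξ : ξ ∉ E) :
    Module.finrank (ZMod 2) (LinearMap.ker (T ξ)) < Module.finrank (ZMod 2) E := by
  have h := Summit.QuantumAdvantage.QuantumAdvantage.Theorems.SignedCubicForrelationInPrBPP.stub_heredity n T E
    hsym₁ hsym₂ hiso hn ξ
  have h' := hnd ξ hξ
  omega

/-- **The M-subspace is the rank locus (non-degenerate regime).** Under the hypotheses of `finrank_ker_lt_of_not_mem`,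
membership in `E` is EQUIVALENT to the rank condition `dim E ≤ dim ker (T ξ)` on the slice of `T` at `ξ`: `E` is cut out
by Gaussian elimination on the cubic tensor, hence unique and decidable pointwise in polynomial time. [folklore] -/
theorem mem_iff_finrank_le {n : ℕ}
    (T : (Fin n → ZMod 2) →ₗ[ZMod 2] (Fin n → ZMod 2) →ₗ[ZMod 2] (Fin n → ZMod 2) →ₗ[ZMod 2] ZMod 2)
    (E : Submodule (ZMod 2) (Fin n → ZMod 2))
    (hsym₁ : ∀ u v w, T u v w = T v u w) (hsym₂ : ∀ u v w, T u v w = T u w v)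
    (hiso : ∀ e ∈ E, ∀ e' ∈ E, ∀ w, T e e' w = 0) (hn : n ≤ 2 * Module.finrank (ZMod 2) E)
    (hnd : ∀ ξ, ξ ∉ E →
      2 * Module.finrank (ZMod 2) ↥(E ⊓ LinearMap.ker (T ξ)) < Module.finrank (ZMod 2) E)
    (ξ : Fin n → ZMod 2) :
    ξ ∈ E ↔ Module.finrank (ZMod 2) E ≤ Module.finrank (ZMod 2) (LinearMap.ker (T ξ)) := by
  constructor
  · intro hξ
    exact Submodule.finrank_mono (le_ker_of_mem T E hsym₁ hiso hξ)
  · intro hle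
    by_contra hξ
    have := finrank_ker_lt_of_not_mem T E hsym₁ hsym₂ hiso hn hnd hξ
    omega

end Summit.QuantumAdvantage.QuantumAdvantage.Theorems.SignedExactCubicForrelationNotPrBPP.Finder

end
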